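import Summits.CriticalPhenomena.CardyFormulaZ2.Theorems.ParafermionPrecompact.Negative.WeakSumControl
import Summits.CriticalPhenomena.CardyFormulaZ2.Theorems.SLE6LimitZ2AllDiscretisations

/-!
# `ParafermionFamiliesToSLESix` (route `CardySusyWard`, stmt-CriticalPhenomena-10814) as typed:
# `WeakHolomorphy` is not load-bearing, and the item is `¬H → (Smirnov's conjecture)`

Negative-side support (cdisprove unit of 10814, cycle 1), consolidating this crux with the negative
lemmas landed by the standing disprover of its second hypothesis `ParafermionPrecompact`
(stmt-11293; `ParafermionPrecompactFalseOfBulkNondegenerate.lean`, `WeakSumControl.lean`):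

* `conclusion_iff_sle6LimitZ2AllDiscretisations` — the conclusion of the crux is, by repackaging
  the six `ZdDiscretisationFamily` fields, the registered OPEN conjecture leaf
  `Summit.CriticalPhenomena.CardyFormulaZ2.SLE6LimitZ2AllDiscretisations` (interface
  `bondInterfaceIn D (Λ δ)` definitionally);
* `parafermionFamiliesToSLESix_iff_precompact_imp` — since, AS TYPED, `ParafermionPrecompact →
  WeakHolomorphy` (`parafermionPrecompact_false_of_not_weakHolomorphy`, sibling file), the first
  hypothesis of the crux is REDUNDANT: `crux ↔ (ParafermionPrecompact → conjecture)`;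
* `parafermionFamiliesToSLESix_iff_not_bulkNondegenerate_imp` — with
  `parafermionPrecompact_iff_not_bulkNondegenerate` (sibling file) the crux reads
  `¬ParafermionBulkNondegenerate → conjecture`: "if the Duminil-Copin–Smirnov normalisation
  `δ^{-1/3}F_δ` degenerates for EVERY domain and EVERY admissible family, then bond percolation on
  `ℤ²` is conformally invariant" — an implication whose antecedent contradicts DCS 2012 Conj. 8.7
  (arXiv:1109.1549, p. 36: `(2δ)^{-σ}F_δ(z) → φ′(z)^σ`, nowhere zero) and carries no usable
  information about the interface;
* `not_parafermionFamiliesToSLESix_iff` — hence a refutation of the typed crux is EXACTLY a proof of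
  `¬ParafermionBulkNondegenerate ∧ ¬SLE6LimitZ2AllDiscretisations`: the degenerate normalisation
  everywhere AND a failure of Smirnov's Conjecture 4 (`q = 1`) along some admissible family. Neither
  conjunct has a handle (the first is an open two-sided bulk estimate for the `q = 1` parafermion,
  the second contradicts universality), so no kill is available; dually the crux is PROVABLE modulo
  the open lower bound `H = ParafermionBulkNondegenerate` for junk reasons (recorded in the crux work
  file `Cruxes/ParafermionFamiliesToSLESix/Disproof.lean`, not landable here). Repair (planner):
  re-point the crux at the edge-guarded `ParafermionPrecompact` (twin `CardyComplexCone`, 11389).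
-/

noncomputable section

namespace Summit.CriticalPhenomena.CardyFormulaZ2.Theorems.ParafermionFamiliesToSLESix.Negative

open scoped Topology
open Filter MeasureTheory Set
open Literature.Probability.LatticeModels Literature.Probability.Percolation
open Literature.Probability.RandomPlanarGeometry
open Summit.CriticalPhenomena.CardyFormulaZ2.Theses.CardySusyWard
open Summit.CriticalPhenomena.CardyFormulaZ2.Theorems.ParafermionPrecompact.Negative
  (parafermionPrecompact_false_of_not_weakHolomorphy parafermionPrecompact_iff_not_bulkNondegenerate)

/-- The conclusion of the crux (verbatim) is the registered open conjecture leaf, by repackaging the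
six unbundled `ZdDiscretisationFamily` fields. [cite: Smirnov2007ICM, §2.3 Conjecture 4] -/
theorem conclusion_iff_sle6LimitZ2AllDiscretisations :
    (∀ (D : DobrushinDomain) (Λ : ℝ → DiscreteDobrushin), (∀ δ, (Λ δ).Ω = D.carrier) →
        (∀ δ, (Λ δ).δ = δ) →
        Tendsto (fun δ : ℝ => Metric.hausdorffEDist (Λ δ).arcA (D.arc 0)) (𝓝[>] (0:ℝ)) (𝓝 0) →
        Tendsto (fun δ : ℝ => Metric.hausdorffEDist (Λ δ).arcB (D.arc 1)) (𝓝[>] (0:ℝ)) (𝓝 0) →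
        Tendsto (fun δ : ℝ => Metric.hausdorffEDist (medialPoint δ '' (Λ δ).zdABEdges)
          {D.pt 0, D.pt 1}) (𝓝[>] (0:ℝ)) (𝓝 0) →
        (∀ᶠ δ in 𝓝[>] (0:ℝ), (Λ δ).IsZdAdmissible) →
        ConvergesInLawToSLE 6 D (Ωδ := fun _ => BondConfig (Site 2))
          (fun δ ω => CurveClass.mk
            (if dist (medialExplorationCurve (Λ δ) ω 0) (D.pt 0) ≤
                dist (medialExplorationCurve (Λ δ) ω 0) (D.pt 1)
              then (⟨medialExplorationCurve (Λ δ) ω⟩ : Curve ℂ)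
              else ⟨(medialExplorationCurve (Λ δ) ω).comp
                ⟨unitInterval.symm, unitInterval.continuous_symm⟩⟩))
          (fun _ => bondPercolation (zdGraph 2) half)) ↔
      Summit.CriticalPhenomena.CardyFormulaZ2.SLE6LimitZ2AllDiscretisations := by
  constructor
  · intro h D E hE
    exact h D E hE.Ω_eq hE.δ_eq hE.tendsto_arcA hE.tendsto_arcB hE.tendsto_zdABEdges
      hE.eventually_isZdAdmissible
  · intro h D Λ h1 h2 h3 h4 h5 h6
    exact h D Λ ⟨h1, h2, h3, h4, h5, h6⟩

/-- Read-back: the crux is `WeakHolomorphy → ParafermionPrecompact → conjecture`. [folklore] -/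
theorem parafermionFamiliesToSLESix_iff_conjecture :
    ParafermionFamiliesToSLESix ↔ (WeakHolomorphy → ParafermionPrecompact →
      Summit.CriticalPhenomena.CardyFormulaZ2.SLE6LimitZ2AllDiscretisations) := by
  rw [← conclusion_iff_sle6LimitZ2AllDiscretisations]
  rfl

/-- **`WeakHolomorphy` is not load-bearing as typed**: since the typed `ParafermionPrecompact`
implies `WeakHolomorphy` (sibling `parafermionPrecompact_false_of_not_weakHolomorphy`), the crux
is equivalent to `ParafermionPrecompact → conjecture`. [folklore] -/
theorem parafermionFamiliesToSLESix_iff_precompact_imp :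
    ParafermionFamiliesToSLESix ↔ (ParafermionPrecompact →
      Summit.CriticalPhenomena.CardyFormulaZ2.SLE6LimitZ2AllDiscretisations) := by
  rw [parafermionFamiliesToSLESix_iff_conjecture]
  refine ⟨fun h hP => h ?_ hP, fun h _ hP => h hP⟩
  by_contra hW
  exact parafermionPrecompact_false_of_not_weakHolomorphy hW hP

/-- **The typed crux is `¬H → conjecture`**, `H = ParafermionBulkNondegenerate` (one admissible
family with `limsup δ^{-1/3} sup_K ‖F_δ‖ > 0`, the weakest consequence of DCS 2012 Conj. 8.7).
[cite: DuminilCopinSmirnov2012Lattice, Conjecture 8.7] -/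
theorem parafermionFamiliesToSLESix_iff_not_bulkNondegenerate_imp :
    ParafermionFamiliesToSLESix ↔ (¬ ParafermionBulkNondegenerate →
      Summit.CriticalPhenomena.CardyFormulaZ2.SLE6LimitZ2AllDiscretisations) := by
  rw [parafermionFamiliesToSLESix_iff_precompact_imp, parafermionPrecompact_iff_not_bulkNondegenerate]

/-- **Refutation shape**: `¬crux ↔ ¬H ∧ ¬conjecture` — a kill must prove that the DCS
normalisation degenerates for every domain and admissible family AND that conformal invariance of
bond percolation on `ℤ²` fails along some admissible family. [folklore] -/
theorem not_parafermionFamiliesToSLESix_iff :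
    ¬ ParafermionFamiliesToSLESix ↔ (¬ ParafermionBulkNondegenerate ∧
      ¬ Summit.CriticalPhenomena.CardyFormulaZ2.SLE6LimitZ2AllDiscretisations) := by
  rw [parafermionFamiliesToSLESix_iff_not_bulkNondegenerate_imp, Classical.not_imp]

end Summit.CriticalPhenomena.CardyFormulaZ2.Theorems.ParafermionFamiliesToSLESix.Negative
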